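import Summits.Schanuel.Schanuel.Theorems.KhovanskiiApproxType.Negative.LoadBearing
import Summits.Schanuel.Schanuel.Theorems.KhovanskiiApproxType.Negative.WithoutKhovanskiiPieces

/-!
# Stage lemma for `¬ KhovanskiiApproxTypeWithoutKhovanskii` (crux `KhovanskiiApproxType`, stmt-Schanuel-6116)

Negative lane, sibling of `Negative/LoadBearing.lean` (heights `natHeight`, Diaz's theorem
`Bugeaud2004_thm_8_11_holds`) and `Negative/WithoutKhovanskiiPieces.lean` (real-analysis pieces).
`stage`: at `θ = (log 2, r log 2, 2, 2^r)` (`0 ≤ r ≤ 1`), a rational `p/q ≤ r` and a degree budget `n`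
satisfying the DEGREE CONDITION `C (nq)^{max a 0} ≤ 0.003 n` and the TAIL CONDITION
`r − p/q < exp(−n K₁)/6` kill the approximation type `(a, b, C)`; the challenger is
`(qα, pα, 2, 2^{p/q}) ∈ ℚ(α, 2^{1/q})` with `α` Diaz's approximation of `ξ = (log 2)/q`.
The assembly (choice of the stage along the tower of `Negative/LiouvilleTower.lean`) is
`Negative/WithoutKhovanskii.lean`. [cite: Bugeaud2004, Thm 8.11]
-/

noncomputable section

set_option linter.dupNamespace false

namespace Summit.Schanuel.Schanuel.Cruxes.KhovanskiiApproxType.Negative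

open Summit.Schanuel.Schanuel.Cruxes.KhovanskiiApproxType.LwSmallHeight
open Polynomial
open Literature.NumberTheory.DiophantineApproximation (Bugeaud2004_thm_8_11_holds
  one_le_mahlerMeasure_map)

set_option maxHeartbeats 800000 in
/-- **Stage lemma.** At `θ = (log 2, r log 2, 2, 2^r)` (`s = (log 2, r·log 2)`, `0 ≤ r ≤ 1`), a rational
`p/q ≤ r` (`1 ≤ p ≤ q`, `2 ≤ q`) and a degree budget `n ≥ 50` satisfying the DEGREE CONDITION
`C (nq)^{max a 0} ≤ 0.003 n` and the TAIL CONDITION `r − p/q < exp(−n K₁)/6`,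
`K₁ = q + 1 + 0.009 n² q + C (nq)^{max b 0}`, kill the approximation type `(a, b, C)`: the challenger is
`γ = (q α, p α, 2, 2^{p/q}) ∈ ℚ(α, 2^{1/q})` with `α` Diaz's approximation of `ξ = (log 2)/q` of degree
`≤ n` at scale `M = exp(K₁/0.006)` (`Bugeaud2004_thm_8_11_holds`), budget `d = nq`,
`H = 2^q q^n H(minpoly α)`. [cite: Bugeaud2004, Thm 8.11] -/
theorem stage (a b C r : ℝ) (p q n : ℕ)
    (hq : 2 ≤ q) (hp : 1 ≤ p) (hpq : p ≤ q) (hn : 50 ≤ n)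
    (hr1 : r ≤ 1) (hpr : (p : ℝ) / q ≤ r)
    (hdeg : C * ((n : ℝ) * q) ^ (max a 0) ≤ 3 / 1000 * n)
    (htail : r - p / q < Real.exp (-((n : ℝ) *
      (q + 1 + 9 / 1000 * (n : ℝ) ^ 2 * q + C * ((n : ℝ) * q) ^ (max b 0)))) / 6) :
    ¬ ApproxTypeAt 2 ![((Real.log 2 : ℝ) : ℂ), ((r * Real.log 2 : ℝ) : ℂ)] a b C := by
  rintro ⟨hC, hall⟩
  -- casts and elementary facts
  have hq1 : (1 : ℝ) ≤ q := by exact_mod_cast (le_trans (by norm_num) hq)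
  have hq2 : (2 : ℝ) ≤ q := by exact_mod_cast hq
  have hqpos : (0 : ℝ) < q := by linarith
  have hqC : (q : ℂ) ≠ 0 := by exact_mod_cast hqpos.ne'
  have hn1nat : 1 ≤ n := le_trans (by norm_num) hn
  have hn2 : (2 : ℝ) ≤ n := by exact_mod_cast (le_trans (by norm_num) hn)
  have hn1 : (1 : ℝ) ≤ n := by linarith
  have hnpos : (0 : ℝ) < n := by linarith
  have hpq' : (p : ℝ) ≤ q := by exact_mod_cast hpq
  have hpq1 : (p : ℝ) / q ≤ 1 := by rw [div_le_one hqpos]; exact hpq'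
  have hδ0 : 0 ≤ r - p / q := by linarith
  have hpq0 : (0 : ℝ) ≤ p / q := by positivity
  have hlog2 : Real.log 2 ≤ 1 := by
    have := Real.log_two_lt_d9; linarith
  have hlog2pos : 0 < Real.log 2 := Real.log_pos (by norm_num)
  -- the constants
  set K1 : ℝ := q + 1 + 9 / 1000 * (n : ℝ) ^ 2 * q + C * ((n : ℝ) * q) ^ (max b 0) with hK1
  have hnqb : 0 ≤ C * ((n : ℝ) * q) ^ (max b 0) := by positivity
  have hK1q : (q : ℝ) + 1 ≤ K1 := by
    have : 0 ≤ 9 / 1000 * (n : ℝ) ^ 2 * q := by positivity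
    linarith
  have hK1pos : 0 < K1 := by linarith
  set M : ℝ := Real.exp (K1 / (6 / 1000)) with hMdef
  have hMpos : 0 < M := Real.exp_pos _
  have hlogM : Real.log M = K1 / (6 / 1000) := by rw [hMdef, Real.log_exp]
  have hM1 : (n : ℝ) + 1 ≤ M := by
    have h1 : (n : ℝ) + 1 ≤ K1 / (6 / 1000) := by
      rw [le_div_iff₀ (by norm_num)]
      have : (n : ℝ) ≤ (n : ℝ) ^ 2 * q := by nlinarith
      nlinarith
    calc (n : ℝ) + 1 ≤ K1 / (6 / 1000) := h1
      _ ≤ K1 / (6 / 1000) + 1 := by linarith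
      _ ≤ M := Real.add_one_le_exp _
  -- ξ = (log 2)/q, and Diaz's hypothesis (4 + |ξ|)^100 ≤ M
  set ξ : ℂ := ((Real.log 2 / q : ℝ) : ℂ) with hξ
  have hξnorm : ‖ξ‖ ≤ 1 := by
    rw [hξ, Complex.norm_real, Real.norm_eq_abs, abs_of_nonneg (by positivity)]
    rw [div_le_one hqpos]; linarith
  have hM2 : (4 + ‖ξ‖) ^ 100 ≤ M := by
    have h5 : (4 + ‖ξ‖) ^ 100 ≤ (5 : ℝ) ^ 100 := by
      exact pow_le_pow_left₀ (by positivity) (by linarith) _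
    have he2 : (5 : ℝ) ≤ Real.exp 2 := by
      have := Real.exp_one_gt_d9
      have h : Real.exp 2 = Real.exp 1 * Real.exp 1 := by rw [← Real.exp_add]; norm_num
      nlinarith
    have h200 : (5 : ℝ) ^ 100 ≤ Real.exp 200 := by
      calc (5 : ℝ) ^ 100 ≤ (Real.exp 2) ^ 100 := pow_le_pow_left₀ (by norm_num) he2 100
        _ = Real.exp 200 := by rw [← Real.exp_nat_mul]; norm_num
    have hK200 : (200 : ℝ) ≤ K1 / (6 / 1000) := by
      rw [le_div_iff₀ (by norm_num)]; linarith
    calc (4 + ‖ξ‖) ^ 100 ≤ (5 : ℝ) ^ 100 := h5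
      _ ≤ Real.exp 200 := h200
      _ ≤ M := Real.exp_le_exp.mpr hK200
  -- Diaz
  obtain ⟨α, P, hPirr, hPα, hPdeg, hPM, hdist⟩ := Bugeaud2004_thm_8_11_holds ξ n M hn hM1 hM2
  have hP0 : P ≠ 0 := hPirr.ne_zero
  have hdP : 1 ≤ P.natDegree := by
    rw [Nat.one_le_iff_ne_zero]
    intro h0
    have hc : P = Polynomial.C (P.coeff 0) := eq_C_of_natDegree_eq_zero h0
    rw [hc, aeval_C, algebraMap_int_eq, eq_intCast, Int.cast_eq_zero] at hPα
    exact hP0 (by rw [hc, hPα, map_zero])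
  set MP : ℝ := (P.map (Int.castRingHom ℂ)).mahlerMeasure with hMP
  have hMP1 : 1 ≤ MP := one_le_mahlerMeasure_map P hP0
  have hlogMP : 0 ≤ Real.log MP := Real.log_nonneg hMP1
  have hlogMPM : Real.log MP ≤ K1 / (6 / 1000) := by
    rw [← hlogM]; exact Real.log_le_log (by linarith) hPM
  have hαint : IsIntegral ℚ α := by
    refine (show IsAlgebraic ℚ α from ⟨P.map (Int.castRingHom ℚ), ?_, ?_⟩).isIntegral
    · exact (Polynomial.map_ne_zero_iff (Int.castRingHom ℚ).injective_int).mpr hP0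
    · rw [← algebraMap_int_eq, aeval_map_algebraMap]; exact hPα
  -- ρ = 2^{p/q}
  set ρ : ℝ := (2 : ℝ) ^ ((p : ℝ) / q) with hρ
  have hρpow : ρ ^ q = (2 : ℝ) ^ p := by
    rw [hρ, ← Real.rpow_natCast, ← Real.rpow_mul (by norm_num), div_mul_cancel₀ _ hqpos.ne',
      Real.rpow_natCast]
  set Q : ℤ[X] := X ^ q - Polynomial.C ((2 : ℤ) ^ p) with hQ
  have hq0 : 0 < q := by omega
  have hQ0 : Q ≠ 0 := X_pow_sub_C_ne_zero hq0 _
  have hQdeg : Q.natDegree = q := natDegree_X_pow_sub_C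
  have hQρ : aeval (ρ : ℂ) Q = 0 := by
    rw [hQ, map_sub, map_pow, aeval_X, aeval_C, algebraMap_int_eq, eq_intCast]
    push_cast
    rw [← Complex.ofReal_pow, hρpow]; push_cast; ring
  have hρint : IsIntegral ℚ (ρ : ℂ) := by
    refine (show IsAlgebraic ℚ (ρ : ℂ) from ⟨Q.map (Int.castRingHom ℚ), ?_, ?_⟩).isIntegral
    · exact (Polynomial.map_ne_zero_iff (Int.castRingHom ℚ).injective_int).mpr hQ0
    · rw [← algebraMap_int_eq, aeval_map_algebraMap]; exact hQρ
  -- the challenger and its budget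
  set H : ℕ := 2 ^ q * q ^ n * natHeight P with hHdef
  have hHP1 : 1 ≤ natHeight P := one_le_natHeight P hP0
  have hH1 : 1 ≤ H := by
    rw [hHdef]
    exact Nat.one_le_iff_ne_zero.mpr (Nat.mul_ne_zero (Nat.mul_ne_zero (by positivity) (by positivity))
      (by omega))
  set d : ℕ := n * q with hddef
  set γ : Fin 2 ⊕ Fin 2 → ℂ := Sum.elim ![(q : ℂ) * α, (p : ℂ) * α] ![(2 : ℂ), (ρ : ℂ)] with hγ
  -- field degree ≤ n q
  have hfr : Module.finrank ℚ ↥(IntermediateField.adjoin ℚ (Set.range γ)) ≤ d := by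
    have hle : IntermediateField.adjoin ℚ (Set.range γ) ≤
        IntermediateField.adjoin ℚ {α} ⊔ IntermediateField.adjoin ℚ {(ρ : ℂ)} := by
      rw [IntermediateField.adjoin_le_iff]
      rintro _ ⟨i, rfl⟩
      have hαmem : α ∈ IntermediateField.adjoin ℚ {α} ⊔ IntermediateField.adjoin ℚ {(ρ : ℂ)} :=
        (le_sup_left : IntermediateField.adjoin ℚ {α} ≤ _) (IntermediateField.mem_adjoin_simple_self ℚ α)
      have hρmem : (ρ : ℂ) ∈ IntermediateField.adjoin ℚ {α} ⊔ IntermediateField.adjoin ℚ {(ρ : ℂ)} :=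
        (le_sup_right : IntermediateField.adjoin ℚ {(ρ : ℂ)} ≤ _)
          (IntermediateField.mem_adjoin_simple_self ℚ (ρ : ℂ))
      rcases i with i | i <;> fin_cases i
      · show (q : ℂ) * α ∈ _
        exact mul_mem (natCast_mem _ q) hαmem
      · show (p : ℂ) * α ∈ _
        exact mul_mem (natCast_mem _ p) hαmem
      · show (2 : ℂ) ∈ _
        exact ofNat_mem _ 2
      · show (ρ : ℂ) ∈ _
        exact hρmem
    haveI : FiniteDimensional ℚ (IntermediateField.adjoin ℚ {α}) :=
      IntermediateField.adjoin.finiteDimensional hαint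
    haveI : FiniteDimensional ℚ (IntermediateField.adjoin ℚ {(ρ : ℂ)}) :=
      IntermediateField.adjoin.finiteDimensional hρint
    have hfa : Module.finrank ℚ (IntermediateField.adjoin ℚ {α}) ≤ n := by
      rw [IntermediateField.adjoin.finrank hαint]
      refine le_trans ?_ hPdeg
      have h := minpoly.degree_le_of_ne_zero ℚ α
        ((Polynomial.map_ne_zero_iff (Int.castRingHom ℚ).injective_int).mpr hP0)
        (by rw [← algebraMap_int_eq, aeval_map_algebraMap]; exact hPα)
      have h' := natDegree_le_natDegree h
      rwa [natDegree_map_eq_of_injective (Int.castRingHom ℚ).injective_int] at h'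
    have hfρ : Module.finrank ℚ (IntermediateField.adjoin ℚ {(ρ : ℂ)}) ≤ q := by
      rw [IntermediateField.adjoin.finrank hρint]
      refine le_trans ?_ hQdeg.le
      have h := minpoly.degree_le_of_ne_zero ℚ (ρ : ℂ)
        ((Polynomial.map_ne_zero_iff (Int.castRingHom ℚ).injective_int).mpr hQ0)
        (by rw [← algebraMap_int_eq, aeval_map_algebraMap]; exact hQρ)
      have h' := natDegree_le_natDegree h
      rwa [natDegree_map_eq_of_injective (Int.castRingHom ℚ).injective_int] at h'
    calc Module.finrank ℚ ↥(IntermediateField.adjoin ℚ (Set.range γ))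
        ≤ Module.finrank ℚ ↥(IntermediateField.adjoin ℚ {α} ⊔ IntermediateField.adjoin ℚ {(ρ : ℂ)}) :=
          IntermediateField.finrank_le_of_le_right hle
      _ ≤ Module.finrank ℚ (IntermediateField.adjoin ℚ {α}) *
            Module.finrank ℚ (IntermediateField.adjoin ℚ {(ρ : ℂ)}) :=
          IntermediateField.finrank_sup_le _ _
      _ ≤ n * q := Nat.mul_le_mul hfa hfρ
  -- the integer polynomials of the four coordinates
  have hHq : q ^ n * natHeight P ≤ H := by
    rw [hHdef, mul_assoc]; exact Nat.le_mul_of_pos_left _ (by positivity)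
  have hH2q : 2 ^ q ≤ H := by
    rw [hHdef, mul_assoc]; exact Nat.le_mul_of_pos_right _ (Nat.mul_pos (by positivity) (by omega))
  have hdn : n ≤ d := by rw [hddef]; exact Nat.le_mul_of_pos_right _ hq0
  have hdq : q ≤ d := by rw [hddef]; exact Nat.le_mul_of_pos_left _ (by omega)
  have hscale : ∀ m : ℕ, 1 ≤ m → m ≤ q → ∃ R : ℤ[X], R ≠ 0 ∧ R.natDegree ≤ d ∧
      (∀ k, |R.coeff k| ≤ (H : ℤ)) ∧ aeval ((m : ℂ) * α) R = 0 := by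
    intro m hm1 hmq
    refine ⟨scaleRoots P (m : ℤ), scaleRoots_ne_zero hP0 _, ?_, ?_, ?_⟩
    · rw [natDegree_scaleRoots]; exact hPdeg.trans hdn
    · intro k
      rw [coeff_scaleRoots, abs_mul]
      have h1 : |P.coeff k| ≤ (natHeight P : ℤ) := abs_coeff_le_natHeight P k
      have h2 : |((m : ℤ)) ^ (P.natDegree - k)| ≤ (q : ℤ) ^ n := by
        rw [abs_pow, Nat.abs_cast]
        calc (m : ℤ) ^ (P.natDegree - k) ≤ (q : ℤ) ^ (P.natDegree - k) :=
              pow_le_pow_left₀ (by positivity) (by exact_mod_cast hmq) _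
          _ ≤ (q : ℤ) ^ n := pow_le_pow_right₀ (by exact_mod_cast hq1) (by omega)
      calc |P.coeff k| * |(m : ℤ) ^ (P.natDegree - k)| ≤ (natHeight P : ℤ) * (q : ℤ) ^ n :=
            mul_le_mul h1 h2 (abs_nonneg _) (by positivity)
        _ = ((q ^ n * natHeight P : ℕ) : ℤ) := by push_cast; ring
        _ ≤ H := by exact_mod_cast hHq
    · have := scaleRoots_aeval_eq_zero (A := ℂ) (r := (m : ℤ)) hPα
      simpa using this
  have hcl : ∀ i, ∃ R : Polynomial ℤ, R ≠ 0 ∧ R.natDegree ≤ d ∧ (∀ k, |R.coeff k| ≤ (H : ℤ)) ∧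
      Polynomial.aeval (γ i) R = 0 := by
    rintro (i | i) <;> fin_cases i
    · exact hscale q (by omega) le_rfl
    · exact hscale p hp hpq
    · refine ⟨X - Polynomial.C 2, X_sub_C_ne_zero 2, ?_, ?_, ?_⟩
      · rw [natDegree_X_sub_C]; exact hn1nat.trans hdn
      · intro k
        have hH2 : (2 : ℤ) ≤ H := by
          have : 2 ≤ 2 ^ q := by
            calc 2 = 2 ^ 1 := by norm_num
              _ ≤ 2 ^ q := Nat.pow_le_pow_right (by norm_num) (by omega)
          exact_mod_cast this.trans hH2q
        rw [coeff_sub, coeff_X, coeff_C]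
        split_ifs <;> simp <;> omega
      · have h2 : aeval (2 : ℂ) (X - Polynomial.C (2 : ℤ)) = 0 := by
          rw [map_sub, aeval_X, aeval_C, algebraMap_int_eq, eq_intCast]; push_cast; ring
        exact h2
    · refine ⟨Q, hQ0, hQdeg.le.trans hdq, ?_, ?_⟩
      · intro k
        have hH2p : (2 : ℤ) ^ p ≤ H := by
          have : 2 ^ p ≤ 2 ^ q := Nat.pow_le_pow_right (by norm_num) hpq
          exact_mod_cast this.trans hH2q
        have hH1' : (1 : ℤ) ≤ H := by exact_mod_cast hH1
        rw [hQ, coeff_sub, coeff_X_pow, coeff_C]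
        split_ifs <;> simp <;> omega
      · exact hQρ
  have key := hall d H γ hfr hcl
  -- (1) distance
  have hqξ : (q : ℂ) * ξ = ((Real.log 2 : ℝ) : ℂ) := by
    rw [hξ]; push_cast; field_simp
  have hpξ : (p : ℂ) * ξ = (((p : ℝ) / q * Real.log 2 : ℝ) : ℂ) := by
    rw [hξ]; push_cast; field_simp
  have hρr : |ρ - (2 : ℝ) ^ r| ≤ 3 * (r - p / q) := by
    rw [abs_sub_comm, abs_of_nonneg (by
      rw [sub_nonneg, hρ]
      exact Real.rpow_le_rpow_of_exponent_le (by norm_num) hpr)]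
    rw [hρ]
    exact two_rpow_sub_le hpq0 hpr hr1
  have hbound := challenger_dist α ξ ρ r ‖ξ - α‖ (r - p / q) p q hqξ hpξ rfl (norm_nonneg _) hpq'
    rfl hδ0 hρr
  -- (2) exponents
  have hdcast : ((d : ℕ) : ℝ) = (n : ℝ) * q := by rw [hddef]; push_cast; ring
  have hHcast : ((H : ℕ) : ℝ) = (2 : ℝ) ^ q * (q : ℝ) ^ n * (natHeight P : ℝ) := by
    rw [hHdef]; push_cast; ring
  have hlogHP : Real.log (natHeight P) ≤ n + Real.log MP := by
    have h1 : (natHeight P : ℝ) ≤ 2 ^ P.natDegree * MP := natHeight_le P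
    have h2 : (2 : ℝ) ^ P.natDegree ≤ 2 ^ n := pow_le_pow_right₀ (by norm_num) hPdeg
    have h3 : (natHeight P : ℝ) ≤ 2 ^ n * MP := h1.trans (by gcongr)
    have h4 : (n : ℝ) * Real.log 2 ≤ n := by
      have := mul_le_mul_of_nonneg_left hlog2 hnpos.le; rwa [mul_one] at this
    calc Real.log (natHeight P) ≤ Real.log (2 ^ n * MP) := Real.log_le_log (by positivity) h3
      _ = n * Real.log 2 + Real.log MP := by
        rw [Real.log_mul (by positivity) (by positivity), Real.log_pow]
      _ ≤ n + Real.log MP := by linarith only [h4]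
  have hlogq : Real.log q ≤ q := by
    have := Real.log_le_sub_one_of_pos hqpos; linarith
  have hlogH : Real.log H ≤ 3 * ((n : ℝ) * q) + Real.log MP := by
    rw [hHcast, Real.log_mul (by positivity) (by positivity), Real.log_mul (by positivity) (by positivity),
      Real.log_pow, Real.log_pow]
    have h1 : (q : ℝ) * Real.log 2 ≤ (n : ℝ) * q := by
      calc (q : ℝ) * Real.log 2 ≤ q * 1 := mul_le_mul_of_nonneg_left hlog2 hqpos.le
        _ ≤ n * q := by rw [mul_one]; exact le_mul_of_one_le_left hqpos.le hn1
    have h2 : (n : ℝ) * Real.log q ≤ (n : ℝ) * q := mul_le_mul_of_nonneg_left hlogq hnpos.le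
    have h3 : (n : ℝ) ≤ (n : ℝ) * q := le_mul_of_one_le_right hnpos.le hq1
    linarith only [h1, h2, h3, hlogHP]
  have hlogH0 : 0 ≤ Real.log H := Real.log_nonneg (by exact_mod_cast hH1)
  have hexpo := expo_bound C n q a b (Real.log H) (Real.log MP) hC.le hn1 hq1 hlogH0 hlogH hlogMP hdeg
  rw [hdcast] at key
  have hK1split : K1 - q - 1 = 9 / 1000 * (n : ℝ) ^ 2 * q + C * ((n : ℝ) * q) ^ (max b 0) := by
    rw [hK1]; ring
  have hX : C * (((n : ℝ) * q) ^ a * Real.log H + ((n : ℝ) * q) ^ b) ≤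
      3 / 1000 * n * Real.log MP + (K1 - q - 1) := by rw [hK1split]; exact hexpo
  rw [hlogM] at hdist
  exact stage_arith n q K1 (Real.log MP) (3 / 1000 * n * Real.log MP + (K1 - q - 1))
    (C * (((n : ℝ) * q) ^ a * Real.log H + ((n : ℝ) * q) ^ b)) ‖ξ - α‖ (r - p / q) P.natDegree
    hn2 hq2 hK1q hlogMP hlogMPM (by exact_mod_cast hdP) rfl hX (key.trans hbound)
    (norm_nonneg _) hdist htail



end Summit.Schanuel.Schanuel.Cruxes.KhovanskiiApproxType.Negative

end
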